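import Summits.QuantumFields.YangMills.Theorems.BalabanUVNodesN21CollarJunctionProjectedCentre
import Summits.QuantumFields.YangMills.Theorems.BalabanUVNodesN21RecentredRoadLevelLedger

/-!
# N21 (NE7c) · THE COLLAR JUNCTIONS AS LEVEL LEDGERS: per live slot the collar END (38m ★★★ on the low-centre road,
# 38n ★★★ on the projected-centre road), monotonised to level letters and pushed through [dict] ⇒
# `T4ShellMeasureLevels.LevelLedger l₀ T A sh S piece lvl (j ↦ M_j·3(d_j+1)∕(1−ρ_j)) ρ` — p583987's ledger shape

R141 (C) seat pub-ymgap-dag-n21-e (g18), node N21 = NE7c (single-run shell-weight bound, NOT PRINTED in [Bałaban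
1983–89], NOT proved), strategy s3 ALTERNATIVE CURRENCY, lane K3⁷ `SpineGivenEndpointR13SepCoPH`
(stmt-QuantumFields-20544, `--kind proof --supports … --as helper`).  Part 38r of this seat's series; the COLLAR twin of
width seat n21-w2's `…N21RecentredRoadLevelLedger` (p587240: §1 `levelLedger_of_recentredDilation` = n21-d's G28 P2 per
live slot, §2 `levelLedger_of_projectedCentre` = G34), offered to this seat first (n21-w2 INTENT-8) and typed here.
Consumes BY NAME: 38m `…N21CollarJunctionLowCentre.slotAntiConcentration_restrict_of_lowCentre_letterwise`, 38n
`…N21CollarJunctionProjectedCentre.slotAntiConcentration_restrict_of_projectedCentre_letterwise`, n21-w2's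
`dilationCoeff_ge_slotConst`, n21-w2 file 1 (p583987) `dilationCoeffConst_nonneg`, pub-balaban's
`T4ShellMeasure.slot_field_of_antiConcentration` and `T4ShellMeasureFibre.slotAntiConcentration_mono`.  Restates nothing.

WHY.  On the COLLAR road (38l ∕ 38m ∕ 38n) n21-d's re-centred END P2 stands with non-collapse `hmono` discharged (low
centre ∕ projected centre), the envelope odds `hQ` DISCHARGED by the collar's per-coordinate conditional odds `Qᵢ`
(38l species, transported under kept cuts reading no collar coordinate), and the envelope clause SPLIT LETTERWISE
(per-letter image clauses + a core clause): per live slot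
`SlotAntiConcentration (ν|({U<θ} ∩ (C⋆ ∩ ⋂ᵢ{q.2 i ∈ P₁ i}))) U θ ρ (3(#κ+1)·∏ᵢ(1+Qᵢ)∕(κ₀(1−ρ)))`.
p587240 turns the UNDISCHARGED-odds roads into p583987's `LevelLedger` with dilation constants; this file does the
same for the collar road — the slot constant is monotonised to level letters `∏ᵢ(1+Qᵢ)∕κ₀ ≤ M_{lvl s}`,
`#κ_s ≤ d_{lvl s}` (§0) and pushed through the [dict] binders — so that the collar road, too, feeds p583987 §2
`shellWeightBound_of_levels_dilationCoeff` ∕ §3 (and n21-w2's port to the reading of record) in ONE application.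

WHAT IS PROVED ([folklore]; one run, slot data indexed by `(K, t, s)` over frame families `X K s`, `κ K s`).
* §0 `collarCoeff_ge_slotConst` — `∏∕κ₀ ≤ M`, `0 ≤ #κ ≤ d`, `0 ≤ M`, `ρ < 1` ⇒
  `3(#κ+1)·∏∕(κ₀(1−ρ)) ≤ M·3(d+1)∕(1−ρ)` (n21-w2 §3 at `Q := ∏ − 1`).
* §1 ★ `levelLedger_of_lowCentre_collar` — per live slot `s ∈ S K`, `|t| ≤ l₀`: product frame
  `X K s × (κ K s → ℝ)`, exterior law `ζ` (s-finite), density `𝟙_{Kcut z}(w)·e^{−φ_z(w)}` with `φ_z` convex on the convex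
  kept cut `Kcut z` and FINITE cut law, a measurable LOW centre `m z ∈ Kcut z` (`hlow`), statistic `U` and core cut
  `C⋆` reading no collar coordinate (`hUi` ∕ `hCi`), collar index set `Mc` with measurable letters `P₁ i ⊆ E₁ i` and
  per-coordinate odds `hodds`, per-letter image clauses `hletter`, core clause `hcore`, radial transversality `hRT`
  (38m ★★★'s binders, displayed per slot); the [dict] push `hpiece` ∕ `hAw`; (R); level letters.  CONCLUSION:
  `LevelLedger l₀ T A sh S piece lvl (j ↦ M_j·3(d_j+1)∕(1−ρ_j)) ρ`.
* §2 ★★ `levelLedger_of_projectedCentre_collar` — the same on G34's road: density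
  `𝟙_{Kcut z}(w)·exp(−(½⟨w − μ z, A(w − μ z)⟩ + P z w))` (`A` symmetric, `γ`-coercive; `P z` `G`-Lipschitz on `Kcut z`),
  dilation about a measurable centre `c z ∈ Kcut z` with obtuse cross terms `hobt` and `2G∕γ`-farness `hfar` in place
  of `hlow` (38n ★★★ per slot).
* A2 ∕ A6 (director-ym STANDING A6 RULE №189 (3)): §1 APPLIED with EVERY binder discharged in the kernel on one live
  slot per step is `…N21CollarJunctionLevelLedgerSanity.collarJunctionLedger_binders_inhabited` (sibling file, 400-line
  rule: 38m′'s one-point witness in ledger form — kept cut `{|w₁| < 1}` reading no collar coordinate, Gaussian `φ`,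
  centre `0`, `U = |w₁|`, ONE collar letter `(−1, 1) ⊂ (−7∕6, 7∕6)` at the Gaussian species odds, [dict] with equality).

HONEST FRAMING.  [textbook] measure theory BY NAME over 38m ∕ 38n and n21-w2's arithmetic; every per-slot letter
(frames, laws, potentials, centres, statistics, cuts, collar letters, odds `Qᵢ`, `κ₀`, the [dict] constants, the level
letters) is a HYPOTHESIS — NODE O's term object ∕ n21-d parts 19 ∕ 27 ∕ 30 ∕ 32 ∕ lens Cards 80–88 (located numbers,
none asserted); nothing of Bałaban's asserted; NE7c NOT PRINTED ∕ NOT proved; N21 NOT discharged; counts UNMOVED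
(typed 28∕28 · discharged 5∕27); count-neutral; one finite four-torus programme at fixed `ε` — NOT ℝ⁴, NOT infinite
volume, NOT OS, NOT a mass gap, NOT Clay.  No decl below carries a cite tag.
-/

set_option autoImplicit false

open MeasureTheory Set Function Matrix
open scoped ENNReal

namespace Summit.QuantumFields.YangMills.Theorems.N21CollarJunctionLevelLedger

open Literature.MathematicalPhysics.QuantumFieldTheory.Balaban1983to89
open Literature.MathematicalPhysics.QuantumFieldTheory.Balaban1983to89.T4ShellMeasure
  (SlotAntiConcentration slot_field_of_antiConcentration)
open Literature.MathematicalPhysics.QuantumFieldTheory.Balaban1983to89.T4ShellMeasureFibre (slotAntiConcentration_mono)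
open T4ShellMeasureLevels (LevelLedger)
open N21CollarJunctionLowCentre (slotAntiConcentration_restrict_of_lowCentre_letterwise)
open N21CollarJunctionProjectedCentre (slotAntiConcentration_restrict_of_projectedCentre_letterwise)
open N21RecentredRoadLevelLedger (dilationCoeff_ge_slotConst)
open N21DilationRoadAtRecord13CoPH (dilationCoeffConst_nonneg)

/-! ## §0 The monotonisation arithmetic for the collar constant -/

/-- **COLLAR SLOT CONSTANT ≤ LEVEL CONSTANT**: `∏∕κ₀ ≤ M`, `0 ≤ #κ ≤ d`, `0 ≤ M`, `ρ < 1` ⇒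
`3(#κ+1)·∏∕(κ₀(1−ρ)) ≤ M·3(d+1)∕(1−ρ)` (n21-w2's `dilationCoeff_ge_slotConst` at `Q := ∏ − 1`). [folklore] -/
theorem collarCoeff_ge_slotConst {cardκ d Pr κ₀ M ρ : ℝ} (hcard : 0 ≤ cardκ) (hd : cardκ ≤ d)
    (hM0 : 0 ≤ M) (hM : Pr / κ₀ ≤ M) (hρ : ρ < 1) :
    3 * (cardκ + 1) * Pr / (κ₀ * (1 - ρ)) ≤ M * (3 * (d + 1) / (1 - ρ)) := by
  have e : 1 + (Pr - 1) = Pr := by ring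
  have h := dilationCoeff_ge_slotConst (Q := Pr - 1) hcard hd hM0 (by rw [e]; exact hM) hρ
  rw [e] at h
  exact h

/-! ## §1 One run: the low-centre collar junction (38m ★★★) as a level ledger -/

section LowCentre

variable {ι σ : Type*} {X : ℕ → σ → Type*} [∀ K s, MeasurableSpace (X K s)] {κ : ℕ → σ → Type*}
  [∀ K s, Fintype (κ K s)] [∀ K s, DecidableEq (κ K s)] [∀ K s, Nonempty (κ K s)]
  {l₀ : ℝ} {T : ℕ → Finset ι} {A sh : ℕ → ℝ → ι → ℝ} {S : ℕ → Finset σ} {piece : ℕ → ℝ → σ → ι → ℝ}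
  {lvl : ℕ → σ → ℕ} {ρ Mlvl d : ℕ → ℝ} {θ κ₀ M₀ : ℕ → ℝ → σ → ℝ}

/-- ★ **THE LOW-CENTRE COLLAR JUNCTION IS A LEVEL LEDGER WITH DILATION CONSTANTS** (one run).  DATA per live slot
`s ∈ S K` at source `|t| ≤ l₀`: a product frame `X K s × (κ K s → ℝ)` with exterior law `ζ K t s` (s-finite), the cut law
`((ζ.prod vol).withDensity 𝟙_{Kcut z}(w)·e^{−φ_z(w)})` FINITE, `φ_z` convex on the convex kept cut `Kcut z`, a measurable
LOW centre `m z ∈ Kcut z` (`hlow` on the shell ∩ cut), statistic `U` and core cut `C⋆` reading no collar coordinate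
(`hUi` ∕ `hCi`), collar index set `Mc` with measurable support ∕ envelope letters `P₁ i ⊆ E₁ i` and per-coordinate
conditional odds `Qᵢ ≥ 0` (`hodds`, for every measurable event not reading `i`), per-letter image clauses `hletter`,
core clause `hcore`, radial transversality `hRT` with `κ₀ > 0`; threshold `θ > 0`, level width `0 < ρ_{lvl} < 1`; the
[dict] push (`hpiece`: the slot's pieces weigh at most `M₀ ×` the restricted cut law's shell mass; `hAw`: `M₀ ×` its
total mass `≤ Σ_τ A`); (R) `0 ≤ sh ≤ A`, `cover`; level letters `0 ≤ M_j`, `0 ≤ d_j` with `∏ᵢ(1+Qᵢ)∕κ₀ ≤ M_{lvl s}`,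
`#κ_s ≤ d_{lvl s}`.  CONCLUSION: `LevelLedger l₀ T A sh S piece lvl (j ↦ M_j·3(d_j+1)∕(1−ρ_j)) ρ` (38m ★★★ ∘
`slotAntiConcentration_mono` ∘ `slot_field_of_antiConcentration` per slot).  HYPOTHESES only; NE7c NOT proved. [folklore] -/
theorem levelLedger_of_lowCentre_collar
    (ζ : ∀ (K : ℕ) (_t : ℝ) (s : σ), Measure (X K s)) (hζ : ∀ K t s, SFinite (ζ K t s))
    {m : ∀ (K : ℕ) (_t : ℝ) (s : σ), X K s → (κ K s → ℝ)} (hm : ∀ K t s, Measurable (m K t s))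
    (Kcut : ∀ (K : ℕ) (_t : ℝ) (s : σ), X K s → Set (κ K s → ℝ))
    (φ : ∀ (K : ℕ) (_t : ℝ) (s : σ), X K s → (κ K s → ℝ) → ℝ)
    (hg : ∀ K t s, Measurable fun p : X K s × (κ K s → ℝ) =>
      (Kcut K t s p.1).indicator (fun w => ENNReal.ofReal (Real.exp (-φ K t s p.1 w))) p.2)
    (hfin : ∀ K t, |t| ≤ l₀ → ∀ s ∈ S K, IsFiniteMeasure (((ζ K t s).prod volume).withDensity
      fun p : X K s × (κ K s → ℝ) => (Kcut K t s p.1).indicator (fun w => ENNReal.ofReal (Real.exp (-φ K t s p.1 w))) p.2))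
    {U : ∀ (K : ℕ) (_t : ℝ) (s : σ), X K s × (κ K s → ℝ) → ℝ} (hUm : ∀ K t s, Measurable (U K t s))
    {Cstar : ∀ (K : ℕ) (_t : ℝ) (s : σ), Set (X K s × (κ K s → ℝ))} (hCstar : ∀ K t s, MeasurableSet (Cstar K t s))
    (Mc : ∀ (K : ℕ) (_t : ℝ) (s : σ), Finset (κ K s)) (P₁ E₁ : ∀ (K : ℕ) (_t : ℝ) (s : σ), κ K s → Set ℝ)
    (hP₁ : ∀ K t s, ∀ i ∈ Mc K t s, MeasurableSet (P₁ K t s i))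
    (hE₁ : ∀ K t s, ∀ i ∈ Mc K t s, MeasurableSet (E₁ K t s i))
    (hPE : ∀ K t s, ∀ i ∈ Mc K t s, P₁ K t s i ⊆ E₁ K t s i)
    (Q : ∀ (K : ℕ) (_t : ℝ) (s : σ), κ K s → ℝ) (hQ0 : ∀ K t s, ∀ i ∈ Mc K t s, 0 ≤ Q K t s i)
    (hodds : ∀ K t, |t| ≤ l₀ → ∀ s ∈ S K, ∀ i ∈ Mc K t s, ∀ C : Set (X K s × (κ K s → ℝ)), MeasurableSet C →
      (∀ (z : X K s) (w : κ K s → ℝ) (y : ℝ), (z, update w i y) ∈ C ↔ (z, w) ∈ C) →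
      (((ζ K t s).prod volume).withDensity fun p : X K s × (κ K s → ℝ) =>
          (Kcut K t s p.1).indicator (fun w => ENNReal.ofReal (Real.exp (-φ K t s p.1 w))) p.2)
          (({q | q.2 i ∈ E₁ K t s i} \ {q | q.2 i ∈ P₁ K t s i}) ∩ C)
        ≤ ENNReal.ofReal (Q K t s i) *
          (((ζ K t s).prod volume).withDensity fun p : X K s × (κ K s → ℝ) =>
            (Kcut K t s p.1).indicator (fun w => ENNReal.ofReal (Real.exp (-φ K t s p.1 w))) p.2)
            ({q | q.2 i ∈ P₁ K t s i} ∩ C))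
    (hUi : ∀ K t s, ∀ i ∈ Mc K t s, ∀ (z : X K s) (w : κ K s → ℝ) (y : ℝ), U K t s (z, update w i y) = U K t s (z, w))
    (hCi : ∀ K t s, ∀ i ∈ Mc K t s, ∀ (z : X K s) (w : κ K s → ℝ) (y : ℝ),
      (z, update w i y) ∈ Cstar K t s ↔ (z, w) ∈ Cstar K t s)
    (hθ : ∀ K t s, 0 < θ K t s) (hρ0 : ∀ j, 0 < ρ j) (hρ1 : ∀ j, ρ j < 1) (hκ : ∀ K t s, 0 < κ₀ K t s)
    (hK : ∀ K t s z, Convex ℝ (Kcut K t s z)) (hφ : ∀ K t s z, ConvexOn ℝ (Kcut K t s z) (φ K t s z))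
    (hmK : ∀ K t s z, m K t s z ∈ Kcut K t s z)
    (hlow : ∀ K t, |t| ≤ l₀ → ∀ s ∈ S K, ∀ p : X K s × (κ K s → ℝ),
      θ K t s * (1 - ρ (lvl K s)) ≤ U K t s p → U K t s p < θ K t s →
      p ∈ Cstar K t s ∩ ⋂ i ∈ Mc K t s, {q : X K s × (κ K s → ℝ) | q.2 i ∈ P₁ K t s i} → p.2 ∈ Kcut K t s p.1 →
        φ K t s p.1 (m K t s p.1) ≤
          φ K t s p.1 (m K t s p.1 + (1 - 1 / ((Fintype.card (κ K s) : ℝ) + 1)) • (p.2 - m K t s p.1)))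
    (hletter : ∀ K t, |t| ≤ l₀ → ∀ s ∈ S K, ∀ i ∈ Mc K t s,
      ∀ l ∈ Icc (1 - 1 / ((Fintype.card (κ K s) : ℝ) + 1)) 1, ∀ (z : X K s) (w : κ K s → ℝ),
      w i ∈ P₁ K t s i → (m K t s z + l • (w - m K t s z)) i ∈ E₁ K t s i)
    (hcore : ∀ K t, |t| ≤ l₀ → ∀ s ∈ S K, ∀ l ∈ Icc (1 - 1 / ((Fintype.card (κ K s) : ℝ) + 1)) 1,
      ∀ p : X K s × (κ K s → ℝ), θ K t s * (1 - ρ (lvl K s)) ≤ U K t s p → U K t s p < θ K t s → p ∈ Cstar K t s →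
        (p.1, m K t s p.1 + l • (p.2 - m K t s p.1)) ∈ {q : X K s × (κ K s → ℝ) | U K t s q < θ K t s} ∩ Cstar K t s)
    (hRT : ∀ K t, |t| ≤ l₀ → ∀ s ∈ S K, ∀ p : X K s × (κ K s → ℝ),
      θ K t s * (1 - ρ (lvl K s)) ≤ U K t s p → U K t s p < θ K t s →
      p ∈ Cstar K t s ∩ ⋂ i ∈ Mc K t s, {q : X K s × (κ K s → ℝ) | q.2 i ∈ P₁ K t s i} → ∀ r : ℝ, 1 ≤ r →
      θ K t s * (1 - ρ (lvl K s)) ≤ U K t s (p.1, m K t s p.1 + r • (p.2 - m K t s p.1)) →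
      U K t s (p.1, m K t s p.1 + r • (p.2 - m K t s p.1)) < θ K t s →
        (p.1, m K t s p.1 + r • (p.2 - m K t s p.1)) ∈
          Cstar K t s ∩ ⋂ i ∈ Mc K t s, {q : X K s × (κ K s → ℝ) | q.2 i ∈ P₁ K t s i} →
          U K t s p + κ₀ K t s * (θ K t s * (1 - ρ (lvl K s))) * (r - 1) ≤
            U K t s (p.1, m K t s p.1 + r • (p.2 - m K t s p.1)))
    (hM₀ : ∀ K t, |t| ≤ l₀ → ∀ s ∈ S K, 0 ≤ M₀ K t s)
    (hpiece : ∀ K t, |t| ≤ l₀ → ∀ s ∈ S K, ∑ τ ∈ T K, piece K t s τ ≤ M₀ K t s *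
      (((((ζ K t s).prod volume).withDensity fun p : X K s × (κ K s → ℝ) =>
          (Kcut K t s p.1).indicator (fun w => ENNReal.ofReal (Real.exp (-φ K t s p.1 w))) p.2).restrict
          ({p | U K t s p < θ K t s} ∩
            (Cstar K t s ∩ ⋂ i ∈ Mc K t s, {q : X K s × (κ K s → ℝ) | q.2 i ∈ P₁ K t s i})))
        {p | θ K t s * (1 - ρ (lvl K s)) ≤ U K t s p ∧ U K t s p < θ K t s}).toReal)
    (hAw : ∀ K t, |t| ≤ l₀ → ∀ s ∈ S K, M₀ K t s *
      (((((ζ K t s).prod volume).withDensity fun p : X K s × (κ K s → ℝ) =>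
          (Kcut K t s p.1).indicator (fun w => ENNReal.ofReal (Real.exp (-φ K t s p.1 w))) p.2).restrict
          ({p | U K t s p < θ K t s} ∩
            (Cstar K t s ∩ ⋂ i ∈ Mc K t s, {q : X K s × (κ K s → ℝ) | q.2 i ∈ P₁ K t s i}))) univ).toReal ≤
        ∑ τ ∈ T K, A K t τ)
    (sh_nonneg : ∀ K t, |t| ≤ l₀ → ∀ τ ∈ T K, 0 ≤ sh K t τ) (sh_le : ∀ K t, |t| ≤ l₀ → ∀ τ ∈ T K, sh K t τ ≤ A K t τ)
    (cover : ∀ K t, |t| ≤ l₀ → ∀ τ ∈ T K, sh K t τ ≤ ∑ s ∈ S K, piece K t s τ)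
    (hM0 : ∀ j, 0 ≤ Mlvl j)
    (hMlvl : ∀ K t, |t| ≤ l₀ → ∀ s ∈ S K, (∏ i ∈ Mc K t s, (1 + Q K t s i)) / κ₀ K t s ≤ Mlvl (lvl K s))
    (hd0 : ∀ j, 0 ≤ d j) (hd : ∀ K, ∀ s ∈ S K, (Fintype.card (κ K s) : ℝ) ≤ d (lvl K s)) :
    LevelLedger l₀ T A sh S piece lvl (fun j => Mlvl j * (3 * (d j + 1) / (1 - ρ j))) ρ where
  sh_nonneg := sh_nonneg
  sh_le := sh_le
  cover := cover
  slot K t ht s hs := by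
    haveI := hζ K t s
    haveI := hfin K t ht s hs
    have hac := slotAntiConcentration_restrict_of_lowCentre_letterwise (ζ K t s) (hm K t s) (Kcut K t s) (φ K t s)
      (hg K t s) (hUm K t s) (hCstar K t s) (Mc K t s) (P₁ K t s) (E₁ K t s) (hP₁ K t s) (hE₁ K t s) (hPE K t s)
      (Q K t s) (hQ0 K t s) (hodds K t ht s hs) (hUi K t s) (hCi K t s) (hθ K t s) (hρ0 _) (hρ1 _) (hκ K t s)
      (hK K t s) (hφ K t s) (hmK K t s) (hlow K t ht s hs) (hletter K t ht s hs) (hcore K t ht s hs)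
      (hRT K t ht s hs)
    have hle := collarCoeff_ge_slotConst (Nat.cast_nonneg _) (hd K s hs) (hM0 _) (hMlvl K t ht s hs) (hρ1 (lvl K s))
    exact slot_field_of_antiConcentration (dilationCoeffConst_nonneg (hM0 _) (hd0 _) (hρ1 _)) (hρ0 _).le
      (slotAntiConcentration_mono (hρ0 _).le hle hac) (T K) (hM₀ K t ht s hs) (hpiece K t ht s hs) (hAw K t ht s hs)
  D_nonneg j := dilationCoeffConst_nonneg (hM0 j) (hd0 j) (hρ1 j)
  ρ_nonneg j := (hρ0 j).le

end LowCentre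

/-! ## §2 One run: the projected-centre collar junction (38n ★★★, G34's road) as a level ledger -/

section ProjectedCentre

variable {ι σ : Type*} {X : ℕ → σ → Type*} [∀ K s, MeasurableSpace (X K s)] {κ : ℕ → σ → Type*}
  [∀ K s, Fintype (κ K s)] [∀ K s, DecidableEq (κ K s)] [∀ K s, Nonempty (κ K s)]
  {l₀ : ℝ} {T : ℕ → Finset ι} {A sh : ℕ → ℝ → ι → ℝ} {S : ℕ → Finset σ} {piece : ℕ → ℝ → σ → ι → ℝ}
  {lvl : ℕ → σ → ℕ} {ρ Mlvl d : ℕ → ℝ} {θ κ₀ M₀ γ G : ℕ → ℝ → σ → ℝ}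

/-- ★★ **THE PROJECTED-CENTRE COLLAR JUNCTION IS A LEVEL LEDGER WITH DILATION CONSTANTS** (one run): §1 with the
density `𝟙_{Kcut z}(w)·exp(−(½⟨w − μ z, Amat(w − μ z)⟩ + P z w))` (Gaussian mean `μ`, symmetric `Amat` with
`γ‖x‖² ≤ ⟨x, Amat x⟩`, `P z` `G`-Lipschitz on the convex kept cut `Kcut z`), the dilation taken about a measurable centre
`c z ∈ Kcut z` with obtuse cross terms `hobt` and `2G∕γ`-farness `hfar` at the shell ∩ cut points (G32's `hmono`
inside 38n); collar letters, odds, image clauses (about `c`), core clause, transversality, [dict], (R) and the level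
letters displayed as in §1 (= 38n ★★★ `slotAntiConcentration_restrict_of_projectedCentre_letterwise` per slot,
monotonised and pushed).  HYPOTHESES only; NE7c NOT proved. [folklore] -/
theorem levelLedger_of_projectedCentre_collar
    (ζ : ∀ (K : ℕ) (_t : ℝ) (s : σ), Measure (X K s)) (hζ : ∀ K t s, SFinite (ζ K t s))
    (Kcut : ∀ (K : ℕ) (_t : ℝ) (s : σ), X K s → Set (κ K s → ℝ))
    (Amat : ∀ (K : ℕ) (_t : ℝ) (s : σ), Matrix (κ K s) (κ K s) ℝ) (hAsymm : ∀ K t s, (Amat K t s).IsSymm)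
    (hγ0 : ∀ K t s, 0 < γ K t s) (hγ : ∀ K t s, ∀ x : κ K s → ℝ, γ K t s * ‖x‖ ^ 2 ≤ x ⬝ᵥ (Amat K t s *ᵥ x))
    (μ : ∀ (K : ℕ) (_t : ℝ) (s : σ), X K s → (κ K s → ℝ))
    {c : ∀ (K : ℕ) (_t : ℝ) (s : σ), X K s → (κ K s → ℝ)} (hc : ∀ K t s, Measurable (c K t s))
    (P : ∀ (K : ℕ) (_t : ℝ) (s : σ), X K s → (κ K s → ℝ) → ℝ)
    (hg : ∀ K t s, Measurable fun p : X K s × (κ K s → ℝ) => (Kcut K t s p.1).indicator (fun w => ENNReal.ofReal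
      (Real.exp (-(1 / 2 * ((w - μ K t s p.1) ⬝ᵥ (Amat K t s *ᵥ (w - μ K t s p.1))) + P K t s p.1 w)))) p.2)
    (hfin : ∀ K t, |t| ≤ l₀ → ∀ s ∈ S K, IsFiniteMeasure (((ζ K t s).prod volume).withDensity
      fun p : X K s × (κ K s → ℝ) => (Kcut K t s p.1).indicator (fun w => ENNReal.ofReal
        (Real.exp (-(1 / 2 * ((w - μ K t s p.1) ⬝ᵥ (Amat K t s *ᵥ (w - μ K t s p.1))) + P K t s p.1 w)))) p.2))
    {U : ∀ (K : ℕ) (_t : ℝ) (s : σ), X K s × (κ K s → ℝ) → ℝ} (hUm : ∀ K t s, Measurable (U K t s))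
    {Cstar : ∀ (K : ℕ) (_t : ℝ) (s : σ), Set (X K s × (κ K s → ℝ))} (hCstar : ∀ K t s, MeasurableSet (Cstar K t s))
    (Mc : ∀ (K : ℕ) (_t : ℝ) (s : σ), Finset (κ K s)) (P₁ E₁ : ∀ (K : ℕ) (_t : ℝ) (s : σ), κ K s → Set ℝ)
    (hP₁ : ∀ K t s, ∀ i ∈ Mc K t s, MeasurableSet (P₁ K t s i))
    (hE₁ : ∀ K t s, ∀ i ∈ Mc K t s, MeasurableSet (E₁ K t s i))
    (hPE : ∀ K t s, ∀ i ∈ Mc K t s, P₁ K t s i ⊆ E₁ K t s i)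
    (Q : ∀ (K : ℕ) (_t : ℝ) (s : σ), κ K s → ℝ) (hQ0 : ∀ K t s, ∀ i ∈ Mc K t s, 0 ≤ Q K t s i)
    (hodds : ∀ K t, |t| ≤ l₀ → ∀ s ∈ S K, ∀ i ∈ Mc K t s, ∀ C : Set (X K s × (κ K s → ℝ)), MeasurableSet C →
      (∀ (z : X K s) (w : κ K s → ℝ) (y : ℝ), (z, update w i y) ∈ C ↔ (z, w) ∈ C) →
      (((ζ K t s).prod volume).withDensity fun p : X K s × (κ K s → ℝ) => (Kcut K t s p.1).indicator (fun w =>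
          ENNReal.ofReal (Real.exp (-(1 / 2 * ((w - μ K t s p.1) ⬝ᵥ (Amat K t s *ᵥ (w - μ K t s p.1))) +
            P K t s p.1 w)))) p.2)
          (({q | q.2 i ∈ E₁ K t s i} \ {q | q.2 i ∈ P₁ K t s i}) ∩ C)
        ≤ ENNReal.ofReal (Q K t s i) *
          (((ζ K t s).prod volume).withDensity fun p : X K s × (κ K s → ℝ) => (Kcut K t s p.1).indicator (fun w =>
            ENNReal.ofReal (Real.exp (-(1 / 2 * ((w - μ K t s p.1) ⬝ᵥ (Amat K t s *ᵥ (w - μ K t s p.1))) +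
              P K t s p.1 w)))) p.2)
            ({q | q.2 i ∈ P₁ K t s i} ∩ C))
    (hUi : ∀ K t s, ∀ i ∈ Mc K t s, ∀ (z : X K s) (w : κ K s → ℝ) (y : ℝ), U K t s (z, update w i y) = U K t s (z, w))
    (hCi : ∀ K t s, ∀ i ∈ Mc K t s, ∀ (z : X K s) (w : κ K s → ℝ) (y : ℝ),
      (z, update w i y) ∈ Cstar K t s ↔ (z, w) ∈ Cstar K t s)
    (hθ : ∀ K t s, 0 < θ K t s) (hρ0 : ∀ j, 0 < ρ j) (hρ1 : ∀ j, ρ j < 1) (hκ : ∀ K t s, 0 < κ₀ K t s)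
    (hK : ∀ K t s z, Convex ℝ (Kcut K t s z)) (hcK : ∀ K t s z, c K t s z ∈ Kcut K t s z)
    (hP : ∀ K t s z, ∀ v ∈ Kcut K t s z, ∀ v' ∈ Kcut K t s z, P K t s z v - P K t s z v' ≤ G K t s * ‖v - v'‖)
    (hobt : ∀ K t, |t| ≤ l₀ → ∀ s ∈ S K, ∀ p : X K s × (κ K s → ℝ),
      θ K t s * (1 - ρ (lvl K s)) ≤ U K t s p → U K t s p < θ K t s →
      p ∈ Cstar K t s ∩ ⋂ i ∈ Mc K t s, {q : X K s × (κ K s → ℝ) | q.2 i ∈ P₁ K t s i} → p.2 ∈ Kcut K t s p.1 →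
        0 ≤ (c K t s p.1 - μ K t s p.1) ⬝ᵥ (Amat K t s *ᵥ (p.2 - c K t s p.1)))
    (hfar : ∀ K t, |t| ≤ l₀ → ∀ s ∈ S K, ∀ p : X K s × (κ K s → ℝ),
      θ K t s * (1 - ρ (lvl K s)) ≤ U K t s p → U K t s p < θ K t s →
      p ∈ Cstar K t s ∩ ⋂ i ∈ Mc K t s, {q : X K s × (κ K s → ℝ) | q.2 i ∈ P₁ K t s i} → p.2 ∈ Kcut K t s p.1 →
        2 * G K t s ≤ γ K t s * ‖p.2 - c K t s p.1‖)
    (hletter : ∀ K t, |t| ≤ l₀ → ∀ s ∈ S K, ∀ i ∈ Mc K t s,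
      ∀ l ∈ Icc (1 - 1 / ((Fintype.card (κ K s) : ℝ) + 1)) 1, ∀ (z : X K s) (w : κ K s → ℝ),
      w i ∈ P₁ K t s i → (c K t s z + l • (w - c K t s z)) i ∈ E₁ K t s i)
    (hcore : ∀ K t, |t| ≤ l₀ → ∀ s ∈ S K, ∀ l ∈ Icc (1 - 1 / ((Fintype.card (κ K s) : ℝ) + 1)) 1,
      ∀ p : X K s × (κ K s → ℝ), θ K t s * (1 - ρ (lvl K s)) ≤ U K t s p → U K t s p < θ K t s → p ∈ Cstar K t s →
        (p.1, c K t s p.1 + l • (p.2 - c K t s p.1)) ∈ {q : X K s × (κ K s → ℝ) | U K t s q < θ K t s} ∩ Cstar K t s)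
    (hRT : ∀ K t, |t| ≤ l₀ → ∀ s ∈ S K, ∀ p : X K s × (κ K s → ℝ),
      θ K t s * (1 - ρ (lvl K s)) ≤ U K t s p → U K t s p < θ K t s →
      p ∈ Cstar K t s ∩ ⋂ i ∈ Mc K t s, {q : X K s × (κ K s → ℝ) | q.2 i ∈ P₁ K t s i} → ∀ r : ℝ, 1 ≤ r →
      θ K t s * (1 - ρ (lvl K s)) ≤ U K t s (p.1, c K t s p.1 + r • (p.2 - c K t s p.1)) →
      U K t s (p.1, c K t s p.1 + r • (p.2 - c K t s p.1)) < θ K t s →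
        (p.1, c K t s p.1 + r • (p.2 - c K t s p.1)) ∈
          Cstar K t s ∩ ⋂ i ∈ Mc K t s, {q : X K s × (κ K s → ℝ) | q.2 i ∈ P₁ K t s i} →
          U K t s p + κ₀ K t s * (θ K t s * (1 - ρ (lvl K s))) * (r - 1) ≤
            U K t s (p.1, c K t s p.1 + r • (p.2 - c K t s p.1)))
    (hM₀ : ∀ K t, |t| ≤ l₀ → ∀ s ∈ S K, 0 ≤ M₀ K t s)
    (hpiece : ∀ K t, |t| ≤ l₀ → ∀ s ∈ S K, ∑ τ ∈ T K, piece K t s τ ≤ M₀ K t s *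
      (((((ζ K t s).prod volume).withDensity fun p : X K s × (κ K s → ℝ) => (Kcut K t s p.1).indicator (fun w =>
          ENNReal.ofReal (Real.exp (-(1 / 2 * ((w - μ K t s p.1) ⬝ᵥ (Amat K t s *ᵥ (w - μ K t s p.1))) +
            P K t s p.1 w)))) p.2).restrict
          ({p | U K t s p < θ K t s} ∩
            (Cstar K t s ∩ ⋂ i ∈ Mc K t s, {q : X K s × (κ K s → ℝ) | q.2 i ∈ P₁ K t s i})))
        {p | θ K t s * (1 - ρ (lvl K s)) ≤ U K t s p ∧ U K t s p < θ K t s}).toReal)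
    (hAw : ∀ K t, |t| ≤ l₀ → ∀ s ∈ S K, M₀ K t s *
      (((((ζ K t s).prod volume).withDensity fun p : X K s × (κ K s → ℝ) => (Kcut K t s p.1).indicator (fun w =>
          ENNReal.ofReal (Real.exp (-(1 / 2 * ((w - μ K t s p.1) ⬝ᵥ (Amat K t s *ᵥ (w - μ K t s p.1))) +
            P K t s p.1 w)))) p.2).restrict
          ({p | U K t s p < θ K t s} ∩
            (Cstar K t s ∩ ⋂ i ∈ Mc K t s, {q : X K s × (κ K s → ℝ) | q.2 i ∈ P₁ K t s i}))) univ).toReal ≤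
        ∑ τ ∈ T K, A K t τ)
    (sh_nonneg : ∀ K t, |t| ≤ l₀ → ∀ τ ∈ T K, 0 ≤ sh K t τ) (sh_le : ∀ K t, |t| ≤ l₀ → ∀ τ ∈ T K, sh K t τ ≤ A K t τ)
    (cover : ∀ K t, |t| ≤ l₀ → ∀ τ ∈ T K, sh K t τ ≤ ∑ s ∈ S K, piece K t s τ)
    (hM0 : ∀ j, 0 ≤ Mlvl j)
    (hMlvl : ∀ K t, |t| ≤ l₀ → ∀ s ∈ S K, (∏ i ∈ Mc K t s, (1 + Q K t s i)) / κ₀ K t s ≤ Mlvl (lvl K s))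
    (hd0 : ∀ j, 0 ≤ d j) (hd : ∀ K, ∀ s ∈ S K, (Fintype.card (κ K s) : ℝ) ≤ d (lvl K s)) :
    LevelLedger l₀ T A sh S piece lvl (fun j => Mlvl j * (3 * (d j + 1) / (1 - ρ j))) ρ where
  sh_nonneg := sh_nonneg
  sh_le := sh_le
  cover := cover
  slot K t ht s hs := by
    haveI := hζ K t s
    haveI := hfin K t ht s hs
    have hac := slotAntiConcentration_restrict_of_projectedCentre_letterwise (ζ K t s) (Kcut K t s) (Amat K t s)
      (hAsymm K t s) (hγ0 K t s) (hγ K t s) (μ K t s) (hc K t s) (P K t s) (hg K t s) (hUm K t s) (hCstar K t s)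
      (Mc K t s) (P₁ K t s) (E₁ K t s) (hP₁ K t s) (hE₁ K t s) (hPE K t s) (Q K t s) (hQ0 K t s) (hodds K t ht s hs)
      (hUi K t s) (hCi K t s) (hθ K t s) (hρ0 _) (hρ1 _) (hκ K t s) (hK K t s) (hcK K t s) (hP K t s)
      (hobt K t ht s hs) (hfar K t ht s hs) (hletter K t ht s hs) (hcore K t ht s hs) (hRT K t ht s hs)
    have hle := collarCoeff_ge_slotConst (Nat.cast_nonneg _) (hd K s hs) (hM0 _) (hMlvl K t ht s hs) (hρ1 (lvl K s))
    exact slot_field_of_antiConcentration (dilationCoeffConst_nonneg (hM0 _) (hd0 _) (hρ1 _)) (hρ0 _).le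
      (slotAntiConcentration_mono (hρ0 _).le hle hac) (T K) (hM₀ K t ht s hs) (hpiece K t ht s hs) (hAw K t ht s hs)
  D_nonneg j := dilationCoeffConst_nonneg (hM0 j) (hd0 j) (hρ1 j)
  ρ_nonneg j := (hρ0 j).le

end ProjectedCentre

end Summit.QuantumFields.YangMills.Theorems.N21CollarJunctionLevelLedger
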